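import Literature.NumberTheory.GaloisRepresentations.TeichmullerCharacter
import Literature.NumberTheory.GaloisRepresentations.GrossencharakterIdeleValue
import Literature.NumberTheory.GaloisRepresentations.PrimaryGeneratorHeckeCharacter
import Literature.NumberTheory.GaloisRepresentations.RayClassGroupModulusChange
import Literature.NumberTheory.QuadraticFields.DiscriminantCharacter
import Literature.NumberTheory.EllipticCurves.EisensteinNewformLevelRaisingDeligneSerreLiftProofs
import Literature.NumberTheory.LFunctions.RayClassCharacter
import Literature.NumberTheory.LFunctions.RayClassGaussSum
import Literature.FieldTheory.AlgClosed.PadicAlgClEquivComplex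
import Mathlib.NumberTheory.LegendreSymbol.JacobiSymbol
import Mathlib.Data.Nat.Factorization.Induction
import HarnessLib

/-!
# Trivial Nebentypus of the twisted Größencharakter at an odd prime: `ψ̃((n)) = (d_K/n)·n` (brick R4)

Route `SignedLowerHalves`, child L `SmallImageLowerHalfBothSigns` (item stmt-BirchSwinnertonDyer-23599), line
proposal `rtt_w3`, stub K0₂@p `stub_heckeThetaPartner_ns` — brick R4 ("trivial Nebentypus") of the arithmetic half at
an ODD prime (width seat `bsd-line-slh-p3-w3` gen 9; memo `Lines/birth_acns-MEMO-w3-g9.md`).  THEOREMS ONLY (no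
definition, no named fact, no `sorry`); ROUTE-INDEPENDENT; pure bookkeeping.

Input: the clauses of the Teichmüller twist `…ThetaPartnerTwist.exists_grossencharakter_twist` at an odd prime `p`
for a totally complex field `K`, `t ∈ ℤ` with `d_K ∣ t`, `p ∤ t` — the unit character `λ` mod `(t)` with
`λ(n̄) = χ_{d_K}(n̄)` (C1), the type-`(1,0)` values `ψ̃₀((b)) = σ(b)λ(b̄)` (C2), `ψ` a Größencharakter mod `(t)` of
type `σ` (C3), and the twist clause `ψ̃((b)) = ψ̃₀((b))·u_b`, `u_b` a root of unity of order prime to `p` with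
`u_b ψ̃₀((b)) ≡ χ̃((b))` for `b` prime to `p t` (C5) — together with the Frobenius congruence
`χ̃((ℓ)) ≡ (d_K/ℓ)·ℓ (mod 𝔪_{ℤ̄_p})` at the odd primes `ℓ ≠ p`, `ℓ ∤ t` (brick R4b, `…ThetaPartnerFrobeniusNorm`).
Output (`idealPow_natCast_eq_jacobiSym_mul_of_twist`): **`ψ̃((n)) = (d_K/n)·n^{2−1}` for every odd `n` prime to
`t`** — the hypothesis `hneb` of the odd socket `…ThetaPartnerOdd.heckeThetaPartner_of_arithmeticHalf`.

Proof.  At an odd prime `ℓ ≠ p`, `ℓ ∤ t`: `ψ̃₀((ℓ)) = ℓ·λ(ℓ̄) = ℓ·(d_K/ℓ) =: m` (Cox: `χ_{d_K}(ℓ̄) = (d_K/ℓ)`), a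
`p`-adic unit, and `u_ℓ m ≡ χ̃((ℓ)) ≡ m`, so `u_ℓ ≡ 1`, hence `u_ℓ = 1` (roots of unity of order prime to `p` are
incongruent) and `ψ̃((ℓ)) = ψ̃₀((ℓ))`.  By multiplicativity `ψ̃((n)) = ψ̃₀((n))` for odd `n` prime to `p t`.  AT THE
PRIME `p` ITSELF (new at odd `p`: `p` is odd and prime to `d_K N((t))`, so `hneb` asks for `ψ̃((p)) = (d_K/p)·p` too):
with `b = p + 2|t|` (odd, prime to `p t`, `b ≡ p mod t`) the Größencharakter relation gives
`ψ̃((b)) = ψ̃((p))σ(b/p)` and `ψ̃₀((b)) = ψ̃₀((p))·(b/p)` (same class `b̄ = p̄`), and `ψ̃((b)) = ψ̃₀((b))` by the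
previous step, so `ψ̃((p)) = ψ̃₀((p))`.  Multiplicativity again gives `ψ̃((n)) = ψ̃₀((n)) = n·(d_K/n)` for all odd
`n` prime to `t`.

BSD, crux L and the stub are NOT proved here.

References: K. Ribet, LNM 601 (1977) §3 (p. 35: `η(a) = ψ((a))/σ(a)^{k−1}`, `ε = ηφ`); D. A. Cox, *Primes of the form
x² + ny²*, §1.C Lemma 1.14; J.-P. Serre, *Local Fields* II §4 Prop. 8.
-/

set_option autoImplicit false
set_option linter.dupNamespace false

noncomputable section

open scoped NumberField
open NumberField IsDedekindDomain
open Literature.NumberTheory.GaloisRepresentations Literature.NumberTheory.LFunctions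
  Literature.NumberTheory.QuadraticFields Literature.NumberTheory.QuadraticFields.Quadratic
  Literature.NumberTheory.EllipticCurves.ModularForms

namespace Summit.BirchSwinnertonDyer.BirchSwinnertonDyer.Theorems.SmallImageLambdaLowerThreeNsThetaPartner

/-! ### §1. A root of unity of order prime to `p` congruent to `1` is `1` -/

section Padic

variable {p : ℕ} [Fact p.Prime]

/-- **Rigidity of roots of unity of order prime to `p`**: if `u^N = 1` with `p ∤ N`, `m` is an integer prime to `p`,
and `‖e⁻¹u · m − m'‖ < 1`, `‖m' − m‖ < 1` for some `m' ∈ ℚ̄_p`, then `u = 1`. [cite: SerreLocalFields1979, Ch. II §4 Prop. 8] -/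
theorem eq_one_of_pow_eq_one_of_congr (e : PadicAlgCl p ≃+* ℂ) {u : ℂ} {N : ℕ} (hN : 0 < N) (hpN : ¬ p ∣ N)
    (hu : u ^ N = 1) {m : ℤ} (hm : ¬ (p : ℤ) ∣ m) {m' : PadicAlgCl p}
    (h1 : ‖e.symm u * (m : PadicAlgCl p) - m'‖ < 1) (h2 : ‖m' - (m : PadicAlgCl p)‖ < 1) : u = 1 := by
  have hmu : ‖(m : PadicAlgCl p)‖ = 1 := DeligneSerreLift.norm_intCast_eq_one_of_not_dvd (p := p) hm
  have hkey : ‖(e.symm u - 1) * (m : PadicAlgCl p)‖ < 1 := by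
    have : (e.symm u - 1) * (m : PadicAlgCl p) = (e.symm u * m - m') + (m' - (m : PadicAlgCl p)) := by ring
    rw [this]
    exact (IsUltrametricDist.norm_add_le_max _ _).trans_lt (max_lt h1 h2)
  rw [norm_mul, hmu, mul_one] at hkey
  have h1' : e.symm u = 1 :=
    eq_of_pow_eq_one_of_norm_sub_lt_one (p := p) hN hpN (by rw [← map_pow, hu, map_one]) (one_pow N) hkey
  exact e.symm.injective (by rw [h1', map_one])

end Padic

/-! ### §2. `ψ̃((n)) = (d_K/n)·n` -/

section Main

variable {K : Type} [Field K] [NumberField K] [IsTotallyComplex K] {p : ℕ} [Fact p.Prime]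

omit [IsTotallyComplex K] in
/-- `(ℓ) ∉ (p)𝓞_K` for distinct rational primes: if `p ∣ ℓ` in `𝓞 K` then `p^{[K:ℚ]} ∣ ℓ^{[K:ℚ]}` in `ℤ` (norms).
[folklore] -/
theorem natCast_not_mem_span_natCast {ℓ : ℕ} (hℓ : ℓ.Prime) (hℓp : ℓ ≠ p) :
    (ℓ : 𝓞 K) ∉ Ideal.span {(p : 𝓞 K)} := by
  intro h
  have hp : p.Prime := Fact.out
  obtain ⟨c, hc⟩ := Ideal.mem_span_singleton'.mp h
  have hdvd : (p : 𝓞 K) ∣ (ℓ : 𝓞 K) := ⟨c, by rw [← hc, mul_comm]⟩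
  have hN := map_dvd (Algebra.norm ℤ) hdvd
  rw [show (p : 𝓞 K) = algebraMap ℤ (𝓞 K) (p : ℤ) by simp, show (ℓ : 𝓞 K) = algebraMap ℤ (𝓞 K) (ℓ : ℤ) by simp,
    Algebra.norm_algebraMap, Algebra.norm_algebraMap] at hN
  have hr : Module.finrank ℤ (𝓞 K) ≠ 0 := Module.finrank_pos.ne'
  rw [Int.pow_dvd_pow_iff hr, Int.natCast_dvd_natCast, Nat.prime_dvd_prime_iff_eq hp hℓ] at hN
  exact hℓp hN.symm

/-- **`ψ̃((n)) = (d_K/n)·n^{2−1}` for odd `n` prime to `t`**, from the clauses of the Teichmüller twist and the Frobenius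
congruence `χ̃((ℓ)) ≡ (d_K/ℓ)·ℓ` at the odd primes `ℓ ≠ p`, `ℓ ∤ t`.  See the module docstring.
[cite: Ribet1977Nebentypus, §3 (p. 35)] [cite: Cox2013, §1.C Lemma 1.14] -/
theorem idealPow_natCast_eq_jacobiSym_mul_of_twist (hp2 : p ≠ 2) (e : PadicAlgCl p ≃+* ℂ) (σ : K →+* ℂ)
    (hd4 : NumberField.discr K % 4 = 0 ∨ NumberField.discr K % 4 = 1)
    {t : ℤ} (hdt : NumberField.discr K ∣ t) (hpt : ¬ (p : ℤ) ∣ t)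
    {lam : (𝓞 K ⧸ Ideal.span {(t : 𝓞 K)})ˣ →* ℂˣ} {ψ₀ ψ χv : HeightOneSpectrum (𝓞 K) → ℂ}
    (hlam : ∀ (n : ℤ) (hn : IsUnit (Ideal.Quotient.mk (Ideal.span {(t : 𝓞 K)}) (n : 𝓞 K))),
      ∃ hu : IsUnit (n : ZMod (NumberField.discr K).natAbs),
        (lam hn.unit : ℂ) = ((discrChar (NumberField.discr K) hu.unit : ℤˣ) : ℤ))
    (hψ₀ : ∀ (b : 𝓞 K), b ≠ 0 → ∀ hb : IsUnit (Ideal.Quotient.mk (Ideal.span {(t : 𝓞 K)}) b),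
      idealPow K ψ₀ (Ideal.span {b}) = σ (b : K) * (lam hb.unit : ℂ))
    (hψG : IsGrossencharakter (Ideal.span {(t : 𝓞 K)}) (embType σ) (embTypeConj σ) ψ)
    (htw : ∀ b : 𝓞 K, b ≠ 0 → b ∉ Ideal.span {(p : 𝓞 K)} →
      IsCoprime (Ideal.span {b}) (Ideal.span {(t : 𝓞 K)}) →
        ∃ u : ℂ, (∃ n : ℕ, 0 < n ∧ ¬ p ∣ n ∧ u ^ n = 1) ∧
          idealPow K ψ (Ideal.span {b}) = idealPow K ψ₀ (Ideal.span {b}) * u ∧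
          ‖e.symm u * e.symm (idealPow K ψ₀ (Ideal.span {b})) - e.symm (idealPow K χv (Ideal.span {b}))‖ < 1)
    (hχ : ∀ ℓ : ℕ, ℓ.Prime → ℓ ≠ p → ℓ ≠ 2 → ¬ (ℓ : ℤ) ∣ t →
      ‖e.symm (idealPow K χv (Ideal.span {(ℓ : 𝓞 K)})) -
        (((ℓ : ℤ) * jacobiSym (NumberField.discr K) ℓ : ℤ) : PadicAlgCl p)‖ < 1) :
    ∀ n : ℕ, Odd n → n.Coprime t.natAbs →
      idealPow K ψ (Ideal.span {(n : 𝓞 K)}) = (jacobiSym (NumberField.discr K) n : ℂ) * (n : ℂ) ^ (2 - 1) := by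
  classical
  have hp : p.Prime := Fact.out
  have hd0 : NumberField.discr K ≠ 0 := NumberField.discr_ne_zero K
  -- units mod `(t)` from coprimality
  have hunit : ∀ n : ℕ, n.Coprime t.natAbs → IsUnit (Ideal.Quotient.mk (Ideal.span {(t : 𝓞 K)}) (n : 𝓞 K)) := by
    intro n hn
    refine isUnit_mk_of_isCoprime ((Ideal.isCoprime_span_singleton_iff _ _).mpr ?_)
    have h1 : IsCoprime (n : ℤ) t := by
      rw [Int.isCoprime_iff_gcd_eq_one, Int.gcd_eq_natAbs, Int.natAbs_natCast]; exact hn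
    simpa using h1.map (Int.castRingHom (𝓞 K))
  have hne : ∀ n : ℕ, n ≠ 0 → (n : 𝓞 K) ≠ 0 := fun n hn => by exact_mod_cast hn
  -- Step 1: `ψ̃₀((n)) = n·(d_K/n)`
  have hψ₀n : ∀ n : ℕ, n ≠ 0 → Odd n → n.Coprime t.natAbs →
      idealPow K ψ₀ (Ideal.span {(n : 𝓞 K)}) = (((n : ℤ) * jacobiSym (NumberField.discr K) n : ℤ) : ℂ) := by
    intro n hn0 hodd hcop
    have hn := hunit n hcop
    have hnZ : IsUnit (Ideal.Quotient.mk (Ideal.span {(t : 𝓞 K)}) ((n : ℤ) : 𝓞 K)) := by rwa [Int.cast_natCast]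
    obtain ⟨hu, hlamv⟩ := hlam n hnZ
    have hunits : hn.unit = hnZ.unit := Units.ext (by rw [IsUnit.unit_spec, IsUnit.unit_spec, Int.cast_natCast])
    have hσn : σ ((n : 𝓞 K) : K) = (n : ℂ) := by
      rw [show ((n : 𝓞 K) : K) = (n : K) by norm_cast, map_natCast]
    rw [hψ₀ (n : 𝓞 K) (hne n hn0) hn, hunits, hlamv,
      discrChar_apply_eq_jacobiSym hd0 hd4 hodd (by rw [IsUnit.unit_spec, Int.cast_natCast]), hσn]
    push_cast
    ring
  -- Step 2: odd primes `ℓ ≠ p`, `ℓ ∤ t`: `ψ̃((ℓ)) = ψ̃₀((ℓ))`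
  have hprime : ∀ ℓ : ℕ, ℓ.Prime → ℓ ≠ 2 → ℓ.Coprime t.natAbs → ℓ ≠ p →
      idealPow K ψ (Ideal.span {(ℓ : 𝓞 K)}) = idealPow K ψ₀ (Ideal.span {(ℓ : 𝓞 K)}) := by
    intro ℓ hℓ hℓ2 hcop hℓp
    have hodd : Odd ℓ := hℓ.odd_of_ne_two hℓ2
    have hℓt : ¬ (ℓ : ℤ) ∣ t := fun h => by
      have : ℓ ∣ t.natAbs := Int.natCast_dvd.mp h
      have := Nat.Coprime.eq_one_of_dvd hcop this
      exact hℓ.one_lt.ne' this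
    obtain ⟨u, ⟨N, hN, hpN, huN⟩, hψu, hcong⟩ := htw (ℓ : 𝓞 K) (hne ℓ hℓ.ne_zero)
      (natCast_not_mem_span_natCast hℓ hℓp)
      ((Ideal.isCoprime_span_singleton_iff _ _).mpr (by
        have h1 : IsCoprime (ℓ : ℤ) t := by
          rw [Int.isCoprime_iff_gcd_eq_one, Int.gcd_eq_natAbs, Int.natAbs_natCast]; exact hcop
        simpa using h1.map (Int.castRingHom (𝓞 K))))
    set m : ℤ := (ℓ : ℤ) * jacobiSym (NumberField.discr K) ℓ with hm
    have hψ₀ℓ := hψ₀n ℓ hℓ.ne_zero hodd hcop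
    have hJ : jacobiSym (NumberField.discr K) ℓ = 1 ∨ jacobiSym (NumberField.discr K) ℓ = -1 :=
      jacobiSym.eq_one_or_neg_one (by
        rw [Int.gcd_eq_natAbs, Int.natAbs_natCast]
        exact ((Nat.Prime.coprime_iff_not_dvd hℓ).mpr fun h => hℓt ((Int.natCast_dvd.mpr h).trans hdt)).symm)
    have hpm : ¬ (p : ℤ) ∣ m := by
      intro h
      have h' : (p : ℤ) ∣ (ℓ : ℤ) := by
        rcases hJ with hJ | hJ
        · rwa [hm, hJ, mul_one] at h
        · rw [hm, hJ, mul_neg_one] at h; exact (dvd_neg).mp h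
      exact hℓp ((Nat.prime_dvd_prime_iff_eq hp hℓ).mp (Int.natCast_dvd_natCast.mp h')).symm
    have h1 : ‖e.symm u * (m : PadicAlgCl p) - e.symm (idealPow K χv (Ideal.span {(ℓ : 𝓞 K)}))‖ < 1 := by
      rw [hψ₀ℓ, map_intCast] at hcong; exact hcong
    have hu1 : u = 1 := eq_one_of_pow_eq_one_of_congr e hN hpN huN hpm h1 (hχ ℓ hℓ hℓp hℓ2 hℓt)
    rw [hψu, hu1, mul_one]
  -- Step 3: multiplicativity
  have hmul : ∀ (good : ℕ → Prop),
      (∀ q : ℕ, q.Prime → q ≠ 2 → q.Coprime t.natAbs → good q →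
        idealPow K ψ (Ideal.span {(q : 𝓞 K)}) = idealPow K ψ₀ (Ideal.span {(q : 𝓞 K)})) →
      ∀ n : ℕ, n ≠ 0 → Odd n → n.Coprime t.natAbs → (∀ q : ℕ, q.Prime → q ∣ n → good q) →
        idealPow K ψ (Ideal.span {(n : 𝓞 K)}) = idealPow K ψ₀ (Ideal.span {(n : 𝓞 K)}) := by
    intro good hgood n
    induction n using induction_on_primes with
    | zero => intro h; exact absurd rfl h
    | one =>
      intro _ _ _ _
      rw [Nat.cast_one, Ideal.span_singleton_one, idealPow_top, idealPow_top]
    | prime_mul q a hq ih =>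
      intro hqa hodd hcop hall
      have ha0 : a ≠ 0 := fun h => hqa (by rw [h, mul_zero])
      have hq2 : q ≠ 2 := by
        rintro rfl
        exact (Nat.not_even_iff_odd.mpr hodd) (even_two_mul a)
      have hqodd : Odd a := (Nat.odd_mul.mp hodd).2
      have hcopq : q.Coprime t.natAbs := Nat.Coprime.coprime_dvd_left (dvd_mul_right q a) hcop
      have hcopa : a.Coprime t.natAbs := Nat.Coprime.coprime_dvd_left (dvd_mul_left a q) hcop
      rw [Nat.cast_mul, ← Ideal.span_singleton_mul_span_singleton,
        idealPow_mul ψ (by rw [Ne, Ideal.span_singleton_eq_bot]; exact hne q hq.ne_zero)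
          (by rw [Ne, Ideal.span_singleton_eq_bot]; exact hne a ha0),
        idealPow_mul ψ₀ (by rw [Ne, Ideal.span_singleton_eq_bot]; exact hne q hq.ne_zero)
          (by rw [Ne, Ideal.span_singleton_eq_bot]; exact hne a ha0),
        hgood q hq hq2 hcopq (hall q hq (dvd_mul_right q a)),
        ih ha0 hqodd hcopa fun r hr hra => hall r hr (hra.mul_left q)]
  -- Step 4: the prime `p` itself, through `b = p + 2|t|`
  have hpcase : p.Coprime t.natAbs →
      idealPow K ψ (Ideal.span {(p : 𝓞 K)}) = idealPow K ψ₀ (Ideal.span {(p : 𝓞 K)}) := by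
    intro hpcop
    have hp2' : Odd p := hp.odd_of_ne_two hp2
    set b : ℕ := p + 2 * t.natAbs with hb
    have hb0 : b ≠ 0 := by rw [hb]; have := hp.pos; omega
    have hbodd : Odd b := by rw [hb]; exact hp2'.add_even (even_two_mul _)
    have hbcop : b.Coprime t.natAbs := by
      rw [hb, Nat.coprime_add_mul_right_left]; exact hpcop
    have hpb : ¬ p ∣ b := by
      intro h
      have h2 : p ∣ 2 * t.natAbs := (Nat.dvd_add_right (dvd_refl p)).mp h
      rcases (Nat.Prime.dvd_mul hp).mp h2 with h3 | h3
      · exact hp2 ((Nat.prime_dvd_prime_iff_eq hp Nat.prime_two).mp h3)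
      · exact hpt (Int.natCast_dvd.mpr h3)
    -- `ψ̃((b)) = ψ̃₀((b))`
    have hbeq := hmul (fun q => q ≠ p) (fun q hq hq2 hqc hqp => hprime q hq hq2 hqc hqp) b hb0 hbodd hbcop
      (fun q hq hqb hqp => hpb (hqp ▸ hqb))
    -- the Größencharakter relation for `ψ`
    have hbp : (b : 𝓞 K) - (p : 𝓞 K) ∈ Ideal.span {(t : 𝓞 K)} := by
      rw [Ideal.mem_span_singleton]
      have h1 : ((b : 𝓞 K) - (p : 𝓞 K)) = 2 * ((t.natAbs : ℕ) : 𝓞 K) := by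
        simp only [hb, Nat.cast_add, Nat.cast_mul, Nat.cast_ofNat]; ring
      have h2 : (t : 𝓞 K) ∣ ((t.natAbs : ℕ) : 𝓞 K) := by
        rw [← Int.cast_natCast]
        exact map_dvd (Int.castRingHom (𝓞 K)) (Int.dvd_natAbs.mpr (dvd_refl t))
      rw [h1]
      exact h2.mul_left 2
    have hpcopI : IsCoprime (Ideal.span {(p : 𝓞 K)}) (Ideal.span {(t : 𝓞 K)}) :=
      (Ideal.isCoprime_span_singleton_iff _ _).mpr (by
        have h1 : IsCoprime (p : ℤ) t := by
          rw [Int.isCoprime_iff_gcd_eq_one, Int.gcd_eq_natAbs, Int.natAbs_natCast]; exact hpcop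
        simpa using h1.map (Int.castRingHom (𝓞 K)))
    have hrel := hψG.idealPow_span_eq (b : 𝓞 K) (p : 𝓞 K) (hne b hb0) (hne p hp.ne_zero) hpcopI hbp
      (fun φ => (not_nonempty_ringHom_real (K := K) φ).elim)
    rw [prod_embedding_zpow_embType] at hrel
    -- the same relation for `ψ₀`, from its values
    have hub := hunit b hbcop
    have hup := hunit p hpcop
    have hunits : hub.unit = hup.unit := Units.ext (by
      rw [IsUnit.unit_spec, IsUnit.unit_spec, Ideal.Quotient.eq]; exact hbp)
    have h0b := hψ₀ (b : 𝓞 K) (hne b hb0) hub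
    have h0p := hψ₀ (p : 𝓞 K) (hne p hp.ne_zero) hup
    rw [hunits] at h0b
    -- compare
    have hσp : σ ((p : 𝓞 K) : K) ≠ 0 := by
      rw [map_ne_zero]; exact_mod_cast hp.ne_zero
    have hσb : σ ((b : 𝓞 K) : K) ≠ 0 := by
      rw [map_ne_zero]; exact_mod_cast hb0
    have hlam0 : (lam hup.unit : ℂ) ≠ 0 := Units.ne_zero _
    rw [hbeq, h0b, map_div₀] at hrel
    -- `σ b · λ = ψ̃((p)) · (σ b / σ p)` ⇒ `ψ̃((p)) = σ p · λ`
    rw [h0p]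
    have h3 : idealPow K ψ (Ideal.span {(p : 𝓞 K)}) * σ ((b : 𝓞 K) : K) =
        σ ((p : 𝓞 K) : K) * (lam hup.unit : ℂ) * σ ((b : 𝓞 K) : K) := by
      have h4 := congrArg (fun z : ℂ => z * σ ((p : 𝓞 K) : K)) hrel
      rw [mul_assoc (idealPow K ψ _), div_mul_cancel₀ _ hσp] at h4
      linear_combination -h4
    exact mul_right_cancel₀ hσb h3
  -- Step 5: all odd `n` prime to `t`
  intro n hn hcop
  have hn0 : n ≠ 0 := by rintro rfl; exact Nat.not_odd_zero hn
  have heq : idealPow K ψ (Ideal.span {(n : 𝓞 K)}) = idealPow K ψ₀ (Ideal.span {(n : 𝓞 K)}) :=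
    hmul (fun _ => True) (fun q hq hq2 hqc _ => by
      by_cases hqp : q = p
      · rw [hqp] at hqc ⊢; exact hpcase hqc
      · exact hprime q hq hq2 hqc hqp) n hn0 hn hcop (fun _ _ _ => trivial)
  rw [heq, hψ₀n n hn0 hn hcop]
  push_cast
  ring

end Main

end Summit.BirchSwinnertonDyer.BirchSwinnertonDyer.Theorems.SmallImageLambdaLowerThreeNsThetaPartner

end
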